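import Mathlib
import Summits.Schanuel.Schanuel.Theses.DiophantineDichotomy

/-!
# Sketch — crux-ideate stmt-Schanuel-6117 (ApproximationProperty), ideator 3, round 1

First lemmas of the three idea cards, stated over Mathlib declarations only.
They are NOT proved here (sorry); they must elaborate.
-/

namespace Summit.Schanuel.Schanuel.Cruxes.ApproximationProperty.Ideator3

open scoped BigOperators
open Classical

/-- Card `amoroso-race-scale-separation`, First lemma (multivariate Dirichlet box principle at a
complex point, the shape of Amoroso LNM1752 Ch.15 Lemma 3.2 / Philippon Ch.8 in the naive
(degree, height) currency): for `θ ∈ ℂⁿ`, a degree bound `Δ ≥ 1` and a height bound `H ≥ 2`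
there is a non-zero integer polynomial of total degree `≤ Δ` and naive height `≤ H` whose value
at `θ` is at most `H ^ (-(N - 2) / 2)` up to the trivial factor `2 N (1 + ‖θ‖)^Δ`, where
`N = C(Δ + n, n)` is the number of monomials.  (Two real conditions, `N` free integers.) -/
theorem dirichlet_box_mv (n Δ H : ℕ) (hΔ : 1 ≤ Δ) (hH : 2 ≤ H) (θ : Fin n → ℂ) :
    ∃ P : MvPolynomial (Fin n) ℤ, P ≠ 0 ∧ P.totalDegree ≤ Δ ∧
      (∀ m, |P.coeff m| ≤ (H : ℤ)) ∧
      ‖MvPolynomial.aeval θ P‖ ≤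
        2 * (Nat.choose (Δ + n) n : ℝ) * (1 + ‖θ‖) ^ Δ *
          (H : ℝ) ^ (-(((Nat.choose (Δ + n) n : ℝ) - 2) / 2)) := by
  sorry

/-- Card `bertini-koszul-generic-sections`, First lemma (anti-concentration of lattice grids on
low-degree hypersurfaces — the Schwartz–Zippel step of "arithmetic Bertini for Dirichlet
systems"): a non-zero real polynomial of total degree `≤ k` in `N` variables cannot vanish at
every point `∑ i, a i • v i` with `|a i| ≤ k` of the grid spanned by `N` linearly independent
integer vectors `v i`. -/
theorem grid_not_on_low_degree_hypersurface (N k : ℕ) (F : MvPolynomial (Fin N) ℝ)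
    (hF : F ≠ 0) (hdeg : F.totalDegree ≤ k) (v : Fin N → (Fin N → ℤ))
    (hv : LinearIndependent ℤ v) :
    ∃ a : Fin N → ℤ, (∀ i, |a i| ≤ k) ∧
      MvPolynomial.eval (fun j => ((∑ i, a i * v i j : ℤ) : ℝ)) F ≠ 0 := by
  sorry

/-- Card `newton-gradient-spread`, First lemma (the arithmetic half of the Newton–Kantorovich
route: a NON-DEGENERATE common zero of `n` integer polynomials in `n` variables is an algebraic
point of degree at most the Bézout number).  -/
theorem nondegenerate_zero_algebraic (n : ℕ) (P : Fin n → MvPolynomial (Fin n) ℤ)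
    (γ : Fin n → ℂ) (h0 : ∀ i, MvPolynomial.aeval γ (P i) = 0)
    (hJ : (Matrix.of fun i j => MvPolynomial.aeval γ (MvPolynomial.pderiv j (P i))).det ≠ 0) :
    (∀ i, IsAlgebraic ℚ (γ i)) ∧
      Module.finrank ℚ ↥(IntermediateField.adjoin ℚ (Set.range γ)) ≤ ∏ i, (P i).totalDegree := by
  sorry


/-- Card `orbit-concentration-veronese-height`, First lemma (one-variable avatar of the
"no conjugate cluster" input: the integrality of the discriminant plus Mahler's bound
`|Disc P| ≤ d^d M(P)^{2d-2}` forbid `k` roots of an irreducible integer polynomial to crowd within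
`e^{-λ}` of a point unless `k(k-1) λ ≤ d(d-1) log 2 + 2(d-1) log M(P)`).  In dimension
`t` the same role is played by the Schmidt height of the span of the conjugate Veronese vectors
(= the arithmetic Hilbert function of the orbit). -/
theorem conjugate_cluster_bound (P : Polynomial ℤ) (hP : Irreducible P) (hd : 2 ≤ P.natDegree)
    (θ : ℂ) (lam : ℝ) :
    let Pc : Polynomial ℂ := P.map (Int.castRingHom ℂ)
    let k : ℕ := (Pc.roots.filter (fun α => ‖α - θ‖ ≤ Real.exp (-lam))).card
    ((k : ℝ) * ((k : ℝ) - 1) / 2) * lam ≤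
      ((P.natDegree : ℝ) * ((P.natDegree : ℝ) - 1) / 2) * Real.log 2 +
        ((P.natDegree : ℝ) - 1) * Real.log Pc.mahlerMeasure := by
  sorry

/-- Sanity: the crux decl is in scope under its route name. -/
example : Prop := Summit.Schanuel.Schanuel.Theses.DiophantineDichotomy.ApproximationProperty

end Summit.Schanuel.Schanuel.Cruxes.ApproximationProperty.Ideator3
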